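import Mathlib.Analysis.SpecialFunctions.Integrals.Basic
import Mathlib.NumberTheory.ArithmeticFunction.Misc
import Mathlib.Data.Fin.Tuple.Finset
import HarnessLib

/-!
# Moments of prime trigonometric polynomials (Tsang 1986, Lemmas 2–3), crude form

Step 4 of the proof programme for Selberg's `Ω`-theorem `Literature.NumberTheory.LFunctions.Selberg1946_zetaArgS_omega`
recorded in `SelbergArgOmega.lean` (§ "Status of the discharge, and a proof programme"): the
moment bounds for the prime polynomial

  `W(t) = Im F(t)`,  `F(t) = ∑_{p ∈ P} a_p e^{-it log p}`  (`P` a finite set of primes `≤ x`, `a_p` real),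

which feed hypotheses (i) and (ii) of Tsang's moment-comparison lemma `Tsang1986_lemma4`
(`TsangMomentComparison.lean`). Everything here is PROVED; there are no definitions and no named
facts (the polynomial is written out in each statement, in the normal form
`∑ p ∈ P, (a p : ℂ) * cexp (↑(-1 * Real.log p * t) * I)`).

K.-M. Tsang, *Some `Ω`-theorems for the Riemann zeta-function*, Acta Arith. **46** (1986),
Lemma 2 (p. 372: the `2k`-th and `(2k+1)`-th moments of `Re/Im ∑ a_p p^{-it}` over `[T, T+H]`,
(2.4)–(2.6)) and Lemma 3 (p. 374: the lower bound `∫ (Re ∑ a_p p^{-it})^{2k} ≥ T (eA)^{-2k} k! (∑ |a_p|²)^k - O(…)`),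
proves these with the Montgomery–Vaughan mean value theorem (his Lemma 1) and sharp constants.
For Selberg's theorem (and for Tsang's Theorem 1) the polynomial has length `x^{2k} ≤ T^{1/16}`
((3.7), p. 381), and then NO mean value theorem is needed: each off-diagonal pair of the expansion
contributes at most `2 x^{2k}` (two distinct integers `n ≠ n'` below `N` have `|log n' - log n| ≥ 1/N`,
`inv_le_abs_log_sub_log`), which is negligible against the length `T` of the diagonal. This file
proves the lemmas in that crude — but, for the application, sufficient — form:

* `abs_integral_im_pow_odd_le` (Lemma 2, (2.5)): `|∫_{T₁}^{T₂} W^{2k+1} dt| ≤ 2 x^{2k+1} (∑_p |a_p|)^{2k+1}`.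
  In an odd power every pair `(f, g)` of tuples in the multinomial expansion has `j ≠ 2k+1-j`
  entries, so by unique factorisation (`cardFactors_tuple_prod`: `Ω(p₁⋯p_j) = j`) the products
  differ and the pair is off-diagonal.
* `integral_im_pow_even_ge` (Lemma 2 (2.4) with the diagonal bounded below as in Lemma 3): for `a_p ≥ 0`,
  `∫_{T₁}^{T₂} W^{2k} dt ≥ 4^{-k} C(2k,k) k! (T₂ - T₁) I_k - 2 x^{2k} (∑_p |a_p|)^{2k}`, where
  `I_k = ∑_{f injective} ∏ᵢ a(fᵢ)²` over injective `k`-tuples in `P`: writing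
  `(2i)^{2k} W^{2k} = (F - conj F)^{2k} = ∑_j (-1)^{j} C(2k,j) F^j conj(F)^{2k-j}`, the terms `j ≠ k` are
  off-diagonal as above, and in `∫ |F|^{2k} = ∑_{f,g} A(f)A(g) ∫ e^{it(log n(g) - log n(f))}` the
  diagonal pairs `n(f) = n(g)` contain, for each injective `f`, the `k!` permutations `g = f ∘ σ`
  (`factorial_mul_sq_le_sum_diag`); all other diagonal pairs are `≥ 0`.
* `prod_sub_le_sum_injective` (the counting step of Lemma 3): if `0 ≤ w ≤ μ` on `P` and
  `S = ∑_P w ≥ (k-1)μ` then `I_k(w) ≥ ∏_{i<k} (S - iμ)`, by the recursion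
  `I_{k+1} ≥ (S - kμ) I_k` (`sum_injective_succ_ge`: a new head avoids the `≤ k` old values, each of
  weight `≤ μ`). Tsang instead cuts the small primes `p ≤ λ = 2k log k` and dyadic blocks; any
  sub-range `P' ⊆ P` may be used (`sum_injective_mono`), which gives the final form
  `integral_im_pow_even_ge_of_subset`:
  `∫ W^{2k} ≥ 4^{-k} C(2k,k) k! (T₂ - T₁) (S' - (k-1)μ)^k - 2 x^{2k} (∑_P |a_p|)^{2k}`,
  `S' = ∑_{P'} a_p²`, `a_p² ≤ μ` on `P'`.

In the application (`SelbergArgOmega.lean`, programme step 5) `x = e^{τ} = (log T)²`, `a_p = w(log p/τ) p^{-1/2}`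
with a fixed bump `w`, `P'` = primes in `(k², e^{3τ/4}]`, so `μ ≤ w(0)²/k²`, `S' ≍ 1`, and with
`k ≍ (log T)^{2/3}/(log log T)²` the error `2x^{2k}(∑|a_p|)^{2k} ≤ 2 (2 w(0) log T)^{4k} = T^{o(1)}` is negligible
against `T (ck)^k`; this yields (i) `∫_T^{2T} W^{2k} ≥ T M₁^{2k}` and (ii)
`|∫_T^{2T} W^{2k+1}| ≤ ½ T M₁^{2k+1}` with `M₁ ≍ √k`.

## Main statements

* `norm_integral_cexp_phase_le`, `inv_le_abs_log_sub_log`, `norm_integral_pair_le` — oscillatory pairs.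
* `primePoly_pow`, `integral_pow_mul_conj_pow` — the multinomial expansion of `∫ F^j conj(F)^l`.
* `norm_integral_pow_mul_conj_pow_le` (`j ≠ l`), `re_integral_pow_mul_conj_pow_ge` (`j = l`).
* `abs_integral_im_pow_odd_le`, `integral_im_pow_even_ge`, `integral_im_pow_even_ge_of_subset`,
  `continuous_im_primePoly`, `abs_im_primePoly_le`.

## References

* [Tsang1986] K.-M. Tsang, *Some Ω-theorems for the Riemann zeta-function*, Acta Arith. 46
  (1986), 369–395: Lemma 2 (pp. 372–374), Lemma 3 (pp. 374–376), §3 (3.7) and p. 382.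
* A. Selberg, *Contributions to the theory of the Riemann zeta-function*, Arch. Math. Naturvid. 48
  (1946) no. 5, §7 (the original moment computation; cited through Tsang).
-/

noncomputable section

open Complex Finset Fintype MeasureTheory intervalIntegral

namespace Literature.NumberTheory.LFunctions

namespace Tsang1986

/-! ### Oscillatory integrals `∫ e^{iθt} dt` -/

/-- `∫_{T₁}^{T₂} e^{iθt} dt = T₂ - T₁` for `θ = 0`. [folklore] -/
theorem integral_cexp_phase_zero (T₁ T₂ : ℝ) :
    ∫ t in T₁..T₂, cexp (↑((0 : ℝ) * t) * I) = (T₂ - T₁ : ℝ) := by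
  simp

/-- `|∫_{T₁}^{T₂} e^{iθt} dt| ≤ 2/|θ|` for `θ ≠ 0`. [folklore] -/
theorem norm_integral_cexp_phase_le {θ : ℝ} (hθ : θ ≠ 0) (T₁ T₂ : ℝ) :
    ‖∫ t in T₁..T₂, cexp (↑(θ * t) * I)‖ ≤ 2 / |θ| := by
  have hc : (θ : ℂ) * I ≠ 0 := mul_ne_zero (ofReal_ne_zero.2 hθ) I_ne_zero
  have h := integral_exp_mul_complex (a := T₁) (b := T₂) hc
  have h' : ∫ t in T₁..T₂, cexp (↑(θ * t) * I) =
      (cexp (↑θ * I * T₂) - cexp (↑θ * I * T₁)) / (↑θ * I) := by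
    rw [← h]
    congr 1 with t
    congr 1
    push_cast
    ring
  rw [h', norm_div, norm_mul, norm_real, norm_I, mul_one, Real.norm_eq_abs]
  gcongr
  refine (norm_sub_le _ _).trans ?_
  have h1 : ‖cexp (↑θ * I * ↑T₂)‖ = 1 := by
    rw [show (θ : ℂ) * I * T₂ = ↑(θ * T₂) * I by push_cast; ring, norm_exp_ofReal_mul_I]
  have h2 : ‖cexp (↑θ * I * ↑T₁)‖ = 1 := by
    rw [show (θ : ℂ) * I * T₁ = ↑(θ * T₁) * I by push_cast; ring, norm_exp_ofReal_mul_I]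
  rw [h1, h2]; norm_num

/-- Distinct positive integers `n ≠ n'` below `N` have `|log n' - log n| ≥ 1/N`. [folklore] -/
theorem inv_le_abs_log_sub_log {n n' : ℕ} (hn : 0 < n) (hn' : 0 < n') (hne : n ≠ n') {N : ℝ}
    (hnN : (n : ℝ) ≤ N) (hn'N : (n' : ℝ) ≤ N) :
    1 / N ≤ |Real.log n' - Real.log n| := by
  -- reduce to `n < n'`
  wlog hlt : n < n' generalizing n n'
  · have h := this hn' hn hne.symm hn'N hnN (lt_of_le_of_ne (not_lt.1 hlt) hne.symm)
    rwa [abs_sub_comm] at h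
  have hn0 : (0 : ℝ) < n := by exact_mod_cast hn
  have hn'0 : (0 : ℝ) < n' := by exact_mod_cast hn'
  have hN : 0 < N := hn0.trans_le hnN
  have hlog : 1 - ((n' : ℝ) / n)⁻¹ ≤ Real.log ((n' : ℝ) / n) :=
    Real.one_sub_inv_le_log_of_pos (div_pos hn'0 hn0)
  rw [inv_div, Real.log_div hn'0.ne' hn0.ne'] at hlog
  have hdiff : (1 : ℝ) ≤ n' - n := by
    have : n + 1 ≤ n' := hlt
    have : ((n : ℝ) + 1) ≤ n' := by exact_mod_cast this
    linarith
  have hkey : 1 / N ≤ 1 - (n : ℝ) / n' := by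
    rw [one_sub_div hn'0.ne', div_le_div_iff₀ hN hn'0]
    nlinarith
  exact hkey.trans (hlog.trans (le_abs_self _))

/-- The pair integral: `∫_{T₁}^{T₂} e^{i(log n' - log n)t} dt` is `T₂ - T₁` on the diagonal `n = n'`,
and has modulus `≤ 2N` off it, for positive integers `n, n' ≤ N`. [folklore] -/
theorem norm_integral_pair_le {n n' : ℕ} (hn : 0 < n) (hn' : 0 < n') (hne : n ≠ n') {N : ℝ}
    (hnN : (n : ℝ) ≤ N) (hn'N : (n' : ℝ) ≤ N) (T₁ T₂ : ℝ) :
    ‖∫ t in T₁..T₂, cexp (↑((Real.log n' - Real.log n) * t) * I)‖ ≤ 2 * N := by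
  have hN : 0 < N := (show (0:ℝ) < n by exact_mod_cast hn).trans_le hnN
  have hθ : Real.log n' - Real.log n ≠ 0 := by
    intro h
    have : (n' : ℝ) = n := Real.log_injOn_pos (Set.mem_Ioi.2 (by exact_mod_cast hn'))
      (Set.mem_Ioi.2 (by exact_mod_cast hn)) (sub_eq_zero.1 h)
    exact hne (by exact_mod_cast this.symm)
  refine (norm_integral_cexp_phase_le hθ T₁ T₂).trans ?_
  have h := inv_le_abs_log_sub_log hn hn' hne hnN hn'N
  rw [div_le_iff₀ (abs_pos.2 hθ)]
  calc (2 : ℝ) = 2 * N * (1 / N) := by field_simp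
    _ ≤ 2 * N * |Real.log n' - Real.log n| := by gcongr

/-- The diagonal pair integral is the length `T₂ - T₁`. [folklore] -/
theorem integral_pair_diag (n : ℕ) (T₁ T₂ : ℝ) :
    ∫ t in T₁..T₂, cexp (↑((Real.log n - Real.log n) * t) * I) = (T₂ - T₁ : ℝ) := by
  simp

variable {P : Finset ℕ} {j : ℕ}

/-! ### Tuples of primes -/

/-- Entries of a tuple of primes are positive. [folklore] -/
theorem tuple_pos (hP : ∀ p ∈ P, p.Prime) {f : Fin j → ℕ} (hf : f ∈ piFinset fun _ : Fin j => P)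
    (i : Fin j) : 0 < f i :=
  (hP _ (mem_piFinset.1 hf i)).pos

/-- The product `n(f) = ∏ᵢ fᵢ` of a tuple of primes is positive. [folklore] -/
theorem tuple_prod_pos (hP : ∀ p ∈ P, p.Prime) {f : Fin j → ℕ}
    (hf : f ∈ piFinset fun _ : Fin j => P) : 0 < ∏ i, f i :=
  prod_pos fun i _ => tuple_pos hP hf i

/-- Unique factorisation in the only form needed: a product of `j` primes has `Ω = j`. [folklore] -/
theorem cardFactors_tuple_prod (hP : ∀ p ∈ P, p.Prime) {f : Fin j → ℕ}
    (hf : f ∈ piFinset fun _ : Fin j => P) :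
    ArithmeticFunction.cardFactors (∏ i, f i) = j := by
  have h0 : (univ.val.map f).prod ≠ 0 := by
    rw [← Finset.prod_eq_multiset_prod]
    exact (tuple_prod_pos hP hf).ne'
  rw [Finset.prod_eq_multiset_prod, ArithmeticFunction.cardFactors_multiset_prod h0,
    Multiset.map_map]
  have : (Multiset.map (⇑ArithmeticFunction.cardFactors ∘ f) (univ : Finset (Fin j)).val) =
      Multiset.map (fun _ => 1) (univ : Finset (Fin j)).val := by
    refine Multiset.map_congr rfl fun i _ => ?_
    simp [ArithmeticFunction.cardFactors_apply_prime (hP _ (mem_piFinset.1 hf i))]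
  rw [this, Multiset.map_const', Multiset.sum_replicate, smul_eq_mul, mul_one]
  simp

/-- Products of `j` primes and of `l` primes can only coincide if `j = l`. [folklore] -/
theorem tuple_prod_ne (hP : ∀ p ∈ P, p.Prime) {l : ℕ} (hjl : j ≠ l) {f : Fin j → ℕ} {g : Fin l → ℕ}
    (hf : f ∈ piFinset fun _ : Fin j => P) (hg : g ∈ piFinset fun _ : Fin l => P) :
    (∏ i, f i) ≠ ∏ i, g i := by
  intro h
  have := congrArg ArithmeticFunction.cardFactors h
  rw [cardFactors_tuple_prod hP hf, cardFactors_tuple_prod hP hg] at this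
  exact hjl this

/-- `n(f) ≤ x^j` for a `j`-tuple of elements `≤ x`. [folklore] -/
theorem tuple_prod_le_pow {x : ℝ} (hx : ∀ p ∈ P, (p : ℝ) ≤ x) {f : Fin j → ℕ}
    (hf : f ∈ piFinset fun _ : Fin j => P) : ((∏ i, f i : ℕ) : ℝ) ≤ x ^ j := by
  calc ((∏ i, f i : ℕ) : ℝ) = ∏ i, (f i : ℝ) := by push_cast; rfl
    _ ≤ ∏ _i : Fin j, x :=
        prod_le_prod (fun i _ => Nat.cast_nonneg _) fun i _ => hx _ (mem_piFinset.1 hf i)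
    _ = x ^ j := by rw [prod_const, card_univ, Fintype.card_fin]

/-- The product of the terms of a tuple: `∏ᵢ a(fᵢ) e^{i c t log fᵢ} = (∏ᵢ a(fᵢ)) e^{i c t log ∏ᵢ fᵢ}`.
[folklore] -/
theorem prod_tuple_terms (hP : ∀ p ∈ P, p.Prime) (a : ℕ → ℝ) (c t : ℝ) {f : Fin j → ℕ}
    (hf : f ∈ piFinset fun _ : Fin j => P) :
    ∏ i, ((a (f i) : ℂ) * cexp (↑(c * Real.log (f i) * t) * I)) =
      (↑(∏ i, a (f i)) : ℂ) * cexp (↑(c * Real.log ((∏ i, f i : ℕ) : ℝ) * t) * I) := by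
  rw [prod_mul_distrib, ← Complex.exp_sum, Nat.cast_prod, Real.log_prod]
  · push_cast
    congr 2
    rw [mul_sum, sum_mul, sum_mul]
  · intro i _
    exact_mod_cast (tuple_pos hP hf i).ne'

/-! ### The prime trigonometric polynomial and its powers -/

/-- `F(t)^j = ∑_f A(f) e^{-it log n(f)}` over `j`-tuples `f` of elements of `P`. [folklore] -/
theorem primePoly_pow (hP : ∀ p ∈ P, p.Prime) (a : ℕ → ℝ) (t : ℝ) (j : ℕ) :
    (∑ p ∈ P, (a p : ℂ) * cexp (↑(-1 * Real.log p * t) * I)) ^ j =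
      ∑ f ∈ piFinset fun _ : Fin j => P,
        (↑(∏ i, a (f i)) : ℂ) * cexp (↑(-1 * Real.log ((∏ i, f i : ℕ) : ℝ) * t) * I) := by
  rw [sum_pow']
  exact sum_congr rfl fun f hf => prod_tuple_terms hP a (-1) t hf

/-- `conj F(t) = ∑_p a_p e^{+it log p}` (real coefficients). [folklore] -/
theorem conj_primePoly (a : ℕ → ℝ) (t : ℝ) (P : Finset ℕ) :
    (starRingEnd ℂ) (∑ p ∈ P, (a p : ℂ) * cexp (↑(-1 * Real.log p * t) * I)) =
      ∑ p ∈ P, (a p : ℂ) * cexp (↑(1 * Real.log p * t) * I) := by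
  rw [map_sum]
  refine sum_congr rfl fun p _ => ?_
  rw [map_mul, conj_ofReal, ← Complex.exp_conj, map_mul, conj_ofReal, conj_I]
  congr 2
  push_cast
  ring

/-- `conj F(t)^l = ∑_g A(g) e^{+it log n(g)}` over `l`-tuples `g`. [folklore] -/
theorem conj_primePoly_pow (hP : ∀ p ∈ P, p.Prime) (a : ℕ → ℝ) (t : ℝ) (l : ℕ) :
    (starRingEnd ℂ) (∑ p ∈ P, (a p : ℂ) * cexp (↑(-1 * Real.log p * t) * I)) ^ l =
      ∑ g ∈ piFinset fun _ : Fin l => P,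
        (↑(∏ i, a (g i)) : ℂ) * cexp (↑(1 * Real.log ((∏ i, g i : ℕ) : ℝ) * t) * I) := by
  rw [conj_primePoly, sum_pow']
  exact sum_congr rfl fun g hg => prod_tuple_terms hP a 1 t hg

/-- The mixed moment `∫ F^j conj(F)^l` as a double sum of pair integrals. [folklore] -/
theorem integral_pow_mul_conj_pow (hP : ∀ p ∈ P, p.Prime) (a : ℕ → ℝ) (j l : ℕ) (T₁ T₂ : ℝ) :
    ∫ t in T₁..T₂, (∑ p ∈ P, (a p : ℂ) * cexp (↑(-1 * Real.log p * t) * I)) ^ j *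
        (starRingEnd ℂ) (∑ p ∈ P, (a p : ℂ) * cexp (↑(-1 * Real.log p * t) * I)) ^ l =
      ∑ f ∈ piFinset fun _ : Fin j => P, ∑ g ∈ piFinset fun _ : Fin l => P,
        (↑((∏ i, a (f i)) * ∏ i, a (g i)) : ℂ) *
          ∫ t in T₁..T₂, cexp (↑((Real.log ((∏ i, g i : ℕ) : ℝ) -
            Real.log ((∏ i, f i : ℕ) : ℝ)) * t) * I) := by
  have hpt : ∀ t : ℝ, (∑ p ∈ P, (a p : ℂ) * cexp (↑(-1 * Real.log p * t) * I)) ^ j *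
        (starRingEnd ℂ) (∑ p ∈ P, (a p : ℂ) * cexp (↑(-1 * Real.log p * t) * I)) ^ l =
      ∑ f ∈ piFinset fun _ : Fin j => P, ∑ g ∈ piFinset fun _ : Fin l => P,
        (↑((∏ i, a (f i)) * ∏ i, a (g i)) : ℂ) *
          cexp (↑((Real.log ((∏ i, g i : ℕ) : ℝ) - Real.log ((∏ i, f i : ℕ) : ℝ)) * t) * I) := by
    intro t
    rw [primePoly_pow hP, conj_primePoly_pow hP, Finset.sum_mul_sum]
    refine sum_congr rfl fun f _ => sum_congr rfl fun g _ => ?_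
    rw [mul_mul_mul_comm, ← Complex.exp_add]
    push_cast
    congr 2
    ring
  simp_rw [hpt]
  rw [intervalIntegral.integral_finsetSum]
  · refine sum_congr rfl fun f _ => ?_
    rw [intervalIntegral.integral_finsetSum]
    · refine sum_congr rfl fun g _ => ?_
      exact intervalIntegral.integral_const_mul _ _
    · intro g _
      exact (Continuous.intervalIntegrable (by fun_prop) _ _)
  · intro f _
    exact Continuous.intervalIntegrable (by fun_prop) _ _

/-! ### Bounds for the mixed moments `M_{j,l} = ∫ F^j conj(F)^l` -/

variable {x : ℝ}

/-- `∑_f |A(f)| = (∑_p |a_p|)^j` over `j`-tuples. [folklore] -/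
theorem sum_abs_tupleCoeff (a : ℕ → ℝ) (j : ℕ) (P : Finset ℕ) :
    ∑ f ∈ piFinset fun _ : Fin j => P, |∏ i, a (f i)| = (∑ p ∈ P, |a p|) ^ j := by
  rw [sum_pow']
  exact sum_congr rfl fun f _ => Finset.abs_prod _ _

/-- `A(f) = ∏ᵢ a(fᵢ) ≥ 0` for non-negative coefficients. [folklore] -/
theorem tupleCoeff_nonneg {a : ℕ → ℝ} (ha : ∀ p ∈ P, 0 ≤ a p) {f : Fin j → ℕ}
    (hf : f ∈ piFinset fun _ : Fin j => P) : 0 ≤ ∏ i, a (f i) :=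
  prod_nonneg fun i _ => ha _ (mem_piFinset.1 hf i)

/-- A single pair integral against its coefficient: off the diagonal it is at most
`|A(f)A(g)| · 2x^{j+l}`. [folklore] -/
theorem norm_pairTerm_le (hP : ∀ p ∈ P, p.Prime) (hx : ∀ p ∈ P, (p : ℝ) ≤ x) (hx1 : 1 ≤ x)
    (a : ℕ → ℝ) {l : ℕ} {f : Fin j → ℕ} {g : Fin l → ℕ}
    (hf : f ∈ piFinset fun _ : Fin j => P) (hg : g ∈ piFinset fun _ : Fin l => P)
    (hne : (∏ i, f i) ≠ ∏ i, g i) (T₁ T₂ : ℝ) :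
    ‖(↑((∏ i, a (f i)) * ∏ i, a (g i)) : ℂ) *
        ∫ t in T₁..T₂, cexp (↑((Real.log ((∏ i, g i : ℕ) : ℝ) -
          Real.log ((∏ i, f i : ℕ) : ℝ)) * t) * I)‖ ≤
      |(∏ i, a (f i)) * ∏ i, a (g i)| * (2 * x ^ (j + l)) := by
  rw [norm_mul, norm_real, Real.norm_eq_abs]
  refine mul_le_mul_of_nonneg_left ?_ (abs_nonneg _)
  refine norm_integral_pair_le (tuple_prod_pos hP hf) (tuple_prod_pos hP hg) hne ?_ ?_ T₁ T₂
  · exact (tuple_prod_le_pow hx hf).trans (pow_le_pow_right₀ hx1 (Nat.le_add_right j l))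
  · exact (tuple_prod_le_pow hx hg).trans (pow_le_pow_right₀ hx1 (Nat.le_add_left l j))

/-- **Off-diagonal mixed moments are small**: for `j ≠ l`, unique factorisation leaves no diagonal
pair, so `|∫_{T₁}^{T₂} F^j conj(F)^l dt| ≤ 2 x^{j+l} (∑_p |a_p|)^{j+l}`, independently of `T₁, T₂`.
[cite: Tsang1986, Lemma 2 (2.5)–(2.6), proof] -/
theorem norm_integral_pow_mul_conj_pow_le (hP : ∀ p ∈ P, p.Prime) (hx : ∀ p ∈ P, (p : ℝ) ≤ x)
    (hx1 : 1 ≤ x) (a : ℕ → ℝ) {j l : ℕ} (hjl : j ≠ l) (T₁ T₂ : ℝ) :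
    ‖∫ t in T₁..T₂, (∑ p ∈ P, (a p : ℂ) * cexp (↑(-1 * Real.log p * t) * I)) ^ j *
        (starRingEnd ℂ) (∑ p ∈ P, (a p : ℂ) * cexp (↑(-1 * Real.log p * t) * I)) ^ l‖ ≤
      2 * x ^ (j + l) * (∑ p ∈ P, |a p|) ^ (j + l) := by
  rw [integral_pow_mul_conj_pow hP]
  calc _ ≤ ∑ f ∈ piFinset fun _ : Fin j => P, ‖∑ g ∈ piFinset fun _ : Fin l => P,
          (↑((∏ i, a (f i)) * ∏ i, a (g i)) : ℂ) *
            ∫ t in T₁..T₂, cexp (↑((Real.log ((∏ i, g i : ℕ) : ℝ) -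
              Real.log ((∏ i, f i : ℕ) : ℝ)) * t) * I)‖ := norm_sum_le _ _
    _ ≤ ∑ f ∈ piFinset fun _ : Fin j => P, ∑ g ∈ piFinset fun _ : Fin l => P,
          |(∏ i, a (f i)) * ∏ i, a (g i)| * (2 * x ^ (j + l)) := by
        refine sum_le_sum fun f hf => (norm_sum_le _ _).trans (sum_le_sum fun g hg => ?_)
        exact norm_pairTerm_le hP hx hx1 a hf hg (tuple_prod_ne hP hjl hf hg) T₁ T₂
    _ = 2 * x ^ (j + l) * ((∑ f ∈ piFinset fun _ : Fin j => P, |∏ i, a (f i)|) *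
          ∑ g ∈ piFinset fun _ : Fin l => P, |∏ i, a (g i)|) := by
        rw [Finset.sum_mul_sum, mul_sum]
        refine sum_congr rfl fun f _ => ?_
        rw [mul_sum]
        refine sum_congr rfl fun g _ => ?_
        rw [abs_mul]; ring
    _ = 2 * x ^ (j + l) * (∑ p ∈ P, |a p|) ^ (j + l) := by
        rw [sum_abs_tupleCoeff, sum_abs_tupleCoeff, ← pow_add]

/-- The permutation pairs on the diagonal: for an injective `k`-tuple `f`, the tuples `f ∘ σ`,
`σ ∈ Perm (Fin k)`, are `k!` distinct tuples with the same product and the same coefficient, so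
`k! · A(f)² ≤ ∑_{g : n(g) = n(f)} A(f) A(g)` when all coefficients are `≥ 0`. [folklore] -/
theorem factorial_mul_sq_le_sum_diag {a : ℕ → ℝ} (ha : ∀ p ∈ P, 0 ≤ a p) {k : ℕ}
    {f : Fin k → ℕ} (hf : f ∈ piFinset fun _ : Fin k => P) (hinj : Function.Injective f) :
    (k.factorial : ℝ) * (∏ i, a (f i)) ^ 2 ≤
      ∑ g ∈ (piFinset fun _ : Fin k => P).filter (fun g => (∏ i, g i) = ∏ i, f i),
        (∏ i, a (f i)) * ∏ i, a (g i) := by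
  classical
  set S := (univ : Finset (Equiv.Perm (Fin k))).image (fun σ : Equiv.Perm (Fin k) => f ∘ σ)
    with hS
  have hsub : S ⊆ (piFinset fun _ : Fin k => P).filter (fun g => (∏ i, g i) = ∏ i, f i) := by
    intro g hg
    obtain ⟨σ, -, rfl⟩ := mem_image.1 hg
    refine mem_filter.2 ⟨mem_piFinset.2 fun i => mem_piFinset.1 hf (σ i), ?_⟩
    exact Equiv.prod_comp σ f
  have hinjσ : Set.InjOn (fun σ : Equiv.Perm (Fin k) => f ∘ ⇑σ) ↑(univ : Finset (Equiv.Perm (Fin k))) := by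
    intro σ _ σ' _ h
    ext i
    exact congrArg Fin.val (hinj (congrFun h i))
  calc (k.factorial : ℝ) * (∏ i, a (f i)) ^ 2
      = ∑ σ ∈ (univ : Finset (Equiv.Perm (Fin k))), (∏ i, a (f i)) * ∏ i, a ((f ∘ σ) i) := by
        have : ∀ σ : Equiv.Perm (Fin k), ∏ i, a ((f ∘ σ) i) = ∏ i, a (f i) := fun σ =>
          Equiv.prod_comp σ (fun i => a (f i))
        simp_rw [this, sum_const, card_univ, Fintype.card_perm, Fintype.card_fin, nsmul_eq_mul]
        ring
    _ = ∑ g ∈ S, (∏ i, a (f i)) * ∏ i, a (g i) := by rw [hS, sum_image hinjσ]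
    _ ≤ _ := sum_le_sum_of_subset_of_nonneg hsub fun g hg _ =>
        mul_nonneg (tupleCoeff_nonneg ha hf) (tupleCoeff_nonneg ha (mem_filter.1 hg).1)

/-- Summing the permutation pairs: `k! ∑_{f injective} A(f)² ≤ ∑_f ∑_{g : n(g) = n(f)} A(f)A(g)`.
[folklore] -/
theorem factorial_mul_sum_sq_le_sum_diag {a : ℕ → ℝ} (ha : ∀ p ∈ P, 0 ≤ a p) (k : ℕ) :
    (k.factorial : ℝ) * ∑ f ∈ (piFinset fun _ : Fin k => P).filter
        (fun f => Function.Injective f), (∏ i, a (f i)) ^ 2 ≤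
      ∑ f ∈ piFinset fun _ : Fin k => P,
        ∑ g ∈ (piFinset fun _ : Fin k => P).filter (fun g => (∏ i, g i) = ∏ i, f i),
          (∏ i, a (f i)) * ∏ i, a (g i) := by
  rw [mul_sum]
  calc _ ≤ ∑ f ∈ (piFinset fun _ : Fin k => P).filter (fun f => Function.Injective f),
        ∑ g ∈ (piFinset fun _ : Fin k => P).filter (fun g => (∏ i, g i) = ∏ i, f i),
          (∏ i, a (f i)) * ∏ i, a (g i) :=
        sum_le_sum fun f hf => factorial_mul_sq_le_sum_diag ha (mem_filter.1 hf).1 (mem_filter.1 hf).2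
    _ ≤ _ := sum_le_sum_of_subset_of_nonneg (filter_subset _ _) fun f hf _ =>
        sum_nonneg fun g hg => mul_nonneg (tupleCoeff_nonneg ha hf)
          (tupleCoeff_nonneg ha (mem_filter.1 hg).1)

/-- **The diagonal mixed moment is large**: with non-negative coefficients,
`Re ∫_{T₁}^{T₂} |F|^{2k} dt ≥ (T₂ - T₁) · k! · ∑_{f injective} A(f)² - 2 x^{2k} (∑_p |a_p|)^{2k}`.
[cite: Tsang1986, Lemma 3, proof] -/
theorem re_integral_pow_mul_conj_pow_ge (hP : ∀ p ∈ P, p.Prime) (hx : ∀ p ∈ P, (p : ℝ) ≤ x)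
    (hx1 : 1 ≤ x) {a : ℕ → ℝ} (ha : ∀ p ∈ P, 0 ≤ a p) (k : ℕ) {T₁ T₂ : ℝ} (hT : T₁ ≤ T₂) :
    (T₂ - T₁) * ((k.factorial : ℝ) * ∑ f ∈ (piFinset fun _ : Fin k => P).filter
        (fun f => Function.Injective f), (∏ i, a (f i)) ^ 2) -
        2 * x ^ (k + k) * (∑ p ∈ P, |a p|) ^ (k + k) ≤
      (∫ t in T₁..T₂, (∑ p ∈ P, (a p : ℂ) * cexp (↑(-1 * Real.log p * t) * I)) ^ k *
        (starRingEnd ℂ) (∑ p ∈ P, (a p : ℂ) * cexp (↑(-1 * Real.log p * t) * I)) ^ k).re := by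
  classical
  rw [integral_pow_mul_conj_pow hP, re_sum]
  -- per `f`: split the `g`-sum into the diagonal and the rest
  have hf_step : ∀ f ∈ piFinset fun _ : Fin k => P,
      (T₂ - T₁) * ∑ g ∈ (piFinset fun _ : Fin k => P).filter (fun g => (∏ i, g i) = ∏ i, f i),
          (∏ i, a (f i)) * ∏ i, a (g i) -
        ∑ g ∈ piFinset fun _ : Fin k => P, |(∏ i, a (f i)) * ∏ i, a (g i)| * (2 * x ^ (k + k)) ≤
      (∑ g ∈ piFinset fun _ : Fin k => P, (↑((∏ i, a (f i)) * ∏ i, a (g i)) : ℂ) *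
          ∫ t in T₁..T₂, cexp (↑((Real.log ((∏ i, g i : ℕ) : ℝ) -
            Real.log ((∏ i, f i : ℕ) : ℝ)) * t) * I)).re := by
    intro f hf
    rw [← sum_filter_add_sum_filter_not (piFinset fun _ : Fin k => P)
      (fun g => (∏ i, g i) = ∏ i, f i) (fun g => (↑((∏ i, a (f i)) * ∏ i, a (g i)) : ℂ) *
          ∫ t in T₁..T₂, cexp (↑((Real.log ((∏ i, g i : ℕ) : ℝ) -
            Real.log ((∏ i, f i : ℕ) : ℝ)) * t) * I)), Complex.add_re, re_sum, re_sum]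
    -- diagonal terms are real and equal to `A f A g (T₂ - T₁)`
    have hdiag : ∀ g ∈ (piFinset fun _ : Fin k => P).filter (fun g => (∏ i, g i) = ∏ i, f i),
        ((↑((∏ i, a (f i)) * ∏ i, a (g i)) : ℂ) *
          ∫ t in T₁..T₂, cexp (↑((Real.log ((∏ i, g i : ℕ) : ℝ) -
            Real.log ((∏ i, f i : ℕ) : ℝ)) * t) * I)).re =
        (T₂ - T₁) * ((∏ i, a (f i)) * ∏ i, a (g i)) := by
      intro g hg
      rw [(mem_filter.1 hg).2, integral_pair_diag]
      rw [← ofReal_mul, ofReal_re]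
      ring
    rw [sum_congr rfl hdiag]
    have hfac : ∑ g ∈ (piFinset fun _ : Fin k => P).filter (fun g => (∏ i, g i) = ∏ i, f i),
        (T₂ - T₁) * ((∏ i, a (f i)) * ∏ i, a (g i)) =
        (T₂ - T₁) * ∑ g ∈ (piFinset fun _ : Fin k => P).filter (fun g => (∏ i, g i) = ∏ i, f i),
          (∏ i, a (f i)) * ∏ i, a (g i) := by rw [mul_sum]
    -- off-diagonal terms: real part `≥ -‖·‖`
    have hoff : ∀ g ∈ (piFinset fun _ : Fin k => P).filter (fun g => ¬ (∏ i, g i) = ∏ i, f i),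
        -(|(∏ i, a (f i)) * ∏ i, a (g i)| * (2 * x ^ (k + k))) ≤
        ((↑((∏ i, a (f i)) * ∏ i, a (g i)) : ℂ) *
          ∫ t in T₁..T₂, cexp (↑((Real.log ((∏ i, g i : ℕ) : ℝ) -
            Real.log ((∏ i, f i : ℕ) : ℝ)) * t) * I)).re := by
      intro g hg
      have hne : (∏ i, f i) ≠ ∏ i, g i := fun h => (mem_filter.1 hg).2 h.symm
      have := norm_pairTerm_le hP hx hx1 a hf (mem_filter.1 hg).1 hne T₁ T₂
      have hre := (abs_re_le_norm ((↑((∏ i, a (f i)) * ∏ i, a (g i)) : ℂ) *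
          ∫ t in T₁..T₂, cexp (↑((Real.log ((∏ i, g i : ℕ) : ℝ) -
            Real.log ((∏ i, f i : ℕ) : ℝ)) * t) * I)))
      have := (neg_le_of_abs_le hre)
      linarith
    have hoff_sum := sum_le_sum hoff
    rw [sum_neg_distrib] at hoff_sum
    have hmono : ∑ g ∈ (piFinset fun _ : Fin k => P).filter (fun g => ¬ (∏ i, g i) = ∏ i, f i),
        |(∏ i, a (f i)) * ∏ i, a (g i)| * (2 * x ^ (k + k)) ≤
        ∑ g ∈ piFinset fun _ : Fin k => P, |(∏ i, a (f i)) * ∏ i, a (g i)| * (2 * x ^ (k + k)) :=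
      sum_le_sum_of_subset_of_nonneg (filter_subset _ _) fun g _ _ => by positivity
    linarith [hfac]
  have hsum := sum_le_sum hf_step
  rw [sum_sub_distrib, ← mul_sum] at hsum
  refine le_trans ?_ hsum
  have hoffTot : ∑ f ∈ piFinset fun _ : Fin k => P, ∑ g ∈ piFinset fun _ : Fin k => P,
      |(∏ i, a (f i)) * ∏ i, a (g i)| * (2 * x ^ (k + k)) =
      2 * x ^ (k + k) * (∑ p ∈ P, |a p|) ^ (k + k) := by
    rw [show (∑ p ∈ P, |a p|) ^ (k + k) = (∑ p ∈ P, |a p|) ^ k * (∑ p ∈ P, |a p|) ^ k from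
      pow_add _ _ _, ← sum_abs_tupleCoeff a k P, Finset.sum_mul_sum, mul_sum]
    refine sum_congr rfl fun f _ => ?_
    rw [mul_sum]
    refine sum_congr rfl fun g _ => ?_
    rw [abs_mul]; ring
  rw [hoffTot]
  have hdiagTot := factorial_mul_sum_sq_le_sum_diag (P := P) ha k
  have hT' : 0 ≤ T₂ - T₁ := sub_nonneg.2 hT
  nlinarith [mul_le_mul_of_nonneg_left hdiagTot hT']

/-! ### Moments of `W = Im F` -/

/-- `(2i)^m (Im z)^m = (z - conj z)^m`, expanded binomially. [folklore] -/
theorem twoI_pow_mul_im_pow (z : ℂ) (m : ℕ) :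
    (2 * I) ^ m * ((z.im : ℝ) : ℂ) ^ m =
      ∑ j ∈ range (m + 1), ((m.choose j : ℕ) : ℂ) * (-1) ^ (m - j) *
        (z ^ j * (starRingEnd ℂ z) ^ (m - j)) := by
  rw [← mul_pow, show 2 * I * ((z.im : ℝ) : ℂ) = z - starRingEnd ℂ z by
    rw [Complex.sub_conj]; push_cast; ring, sub_eq_add_neg, add_pow]
  refine sum_congr rfl fun j _ => ?_
  rw [neg_pow]
  ring

/-- The moment identity: `(2i)^m ∫ W^m = ∑_j C(m,j) (-1)^{m-j} ∫ F^j conj(F)^{m-j}`. [folklore] -/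
theorem twoI_pow_mul_integral_im_pow (a : ℕ → ℝ) (P : Finset ℕ) (m : ℕ) (T₁ T₂ : ℝ) :
    (2 * I) ^ m * ((∫ t in T₁..T₂,
        (∑ p ∈ P, (a p : ℂ) * cexp (↑(-1 * Real.log p * t) * I)).im ^ m : ℝ) : ℂ) =
      ∑ j ∈ range (m + 1), ((m.choose j : ℕ) : ℂ) * (-1) ^ (m - j) *
        ∫ t in T₁..T₂, (∑ p ∈ P, (a p : ℂ) * cexp (↑(-1 * Real.log p * t) * I)) ^ j *
          (starRingEnd ℂ) (∑ p ∈ P, (a p : ℂ) * cexp (↑(-1 * Real.log p * t) * I)) ^ (m - j) := by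
  rw [← intervalIntegral.integral_ofReal, ← intervalIntegral.integral_const_mul]
  simp_rw [ofReal_pow]
  rw [intervalIntegral.integral_congr (g := fun t => ∑ j ∈ range (m + 1),
      ((m.choose j : ℕ) : ℂ) * (-1) ^ (m - j) *
        ((∑ p ∈ P, (a p : ℂ) * cexp (↑(-1 * Real.log p * t) * I)) ^ j *
          (starRingEnd ℂ) (∑ p ∈ P, (a p : ℂ) * cexp (↑(-1 * Real.log p * t) * I)) ^ (m - j)))
      (fun t _ => twoI_pow_mul_im_pow _ m),
    intervalIntegral.integral_finsetSum]
  · refine sum_congr rfl fun j _ => ?_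
    exact intervalIntegral.integral_const_mul _ _
  · intro j _
    exact Continuous.intervalIntegrable (by fun_prop) _ _

/-- **Odd moments of `W` are small** (Tsang 1986, Lemma 2 (2.5) in the crude form that suffices
here): `|∫_{T₁}^{T₂} W(t)^{2k+1} dt| ≤ 2 x^{2k+1} (∑_p |a_p|)^{2k+1}` — every pair in the expansion
is off-diagonal, since `j ≠ 2k+1-j`. [cite: Tsang1986, Lemma 2 (2.5)] -/
theorem abs_integral_im_pow_odd_le (hP : ∀ p ∈ P, p.Prime) (hx : ∀ p ∈ P, (p : ℝ) ≤ x)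
    (hx1 : 1 ≤ x) (a : ℕ → ℝ) (k : ℕ) (T₁ T₂ : ℝ) :
    |∫ t in T₁..T₂, (∑ p ∈ P, (a p : ℂ) * cexp (↑(-1 * Real.log p * t) * I)).im ^ (2 * k + 1)| ≤
      2 * x ^ (2 * k + 1) * (∑ p ∈ P, |a p|) ^ (2 * k + 1) := by
  set m := 2 * k + 1 with hm
  set E : ℝ := 2 * x ^ m * (∑ p ∈ P, |a p|) ^ m with hE
  have hid := twoI_pow_mul_integral_im_pow a P m T₁ T₂
  have hnorm : ‖(2 * I : ℂ) ^ m‖ = 2 ^ m := by simp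
  have hE0 : 0 ≤ E := by positivity
  -- the right-hand side has norm at most `∑_j C(m,j) E = 2^m E`
  have hbound : ‖∑ j ∈ range (m + 1), ((m.choose j : ℕ) : ℂ) * (-1) ^ (m - j) *
        ∫ t in T₁..T₂, (∑ p ∈ P, (a p : ℂ) * cexp (↑(-1 * Real.log p * t) * I)) ^ j *
          (starRingEnd ℂ) (∑ p ∈ P, (a p : ℂ) * cexp (↑(-1 * Real.log p * t) * I)) ^ (m - j)‖ ≤
      2 ^ m * E := by
    refine (norm_sum_le _ _).trans ?_
    calc _ ≤ ∑ j ∈ range (m + 1), (m.choose j : ℝ) * E := by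
          refine sum_le_sum fun j hj => ?_
          have hjm : j ≤ m := Nat.lt_succ_iff.1 (mem_range.1 hj)
          have hjl : j ≠ m - j := by omega
          rw [norm_mul, norm_mul, norm_pow, norm_neg, norm_one, one_pow, mul_one, norm_natCast]
          refine mul_le_mul_of_nonneg_left ?_ (Nat.cast_nonneg _)
          have := norm_integral_pow_mul_conj_pow_le hP hx hx1 a hjl T₁ T₂
          rwa [Nat.add_sub_cancel' hjm] at this
      _ = 2 ^ m * E := by
          rw [← sum_mul, ← Nat.cast_sum, Nat.sum_range_choose]; push_cast; ring
  have h2 : (2 : ℝ) ^ m * |∫ t in T₁..T₂,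
      (∑ p ∈ P, (a p : ℂ) * cexp (↑(-1 * Real.log p * t) * I)).im ^ m| ≤ 2 ^ m * E := by
    have := congrArg norm hid
    rw [norm_mul, hnorm, norm_real, Real.norm_eq_abs] at this
    rw [this]
    exact hbound
  exact le_of_mul_le_mul_left h2 (by positivity)

/-- **Even moments of `W` are large** (Tsang 1986, Lemma 2 (2.4) with the diagonal bounded below
as in the proof of his Lemma 3, in the crude form that suffices here): for coefficients `a_p ≥ 0`,
`∫_{T₁}^{T₂} W(t)^{2k} dt ≥ 4^{-k} C(2k,k) k! (T₂ - T₁) ∑_{f injective} ∏ᵢ a(fᵢ)² - 2 x^{2k} (∑_p |a_p|)^{2k}`.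
[cite: Tsang1986, Lemma 2 (2.4) and Lemma 3] -/
theorem integral_im_pow_even_ge (hP : ∀ p ∈ P, p.Prime) (hx : ∀ p ∈ P, (p : ℝ) ≤ x)
    (hx1 : 1 ≤ x) {a : ℕ → ℝ} (ha : ∀ p ∈ P, 0 ≤ a p) (k : ℕ) {T₁ T₂ : ℝ} (hT : T₁ ≤ T₂) :
    ((2 * k).choose k : ℝ) / 4 ^ k * ((T₂ - T₁) * ((k.factorial : ℝ) *
        ∑ f ∈ (piFinset fun _ : Fin k => P).filter (fun f => Function.Injective f),
          (∏ i, a (f i)) ^ 2)) - 2 * x ^ (2 * k) * (∑ p ∈ P, |a p|) ^ (2 * k) ≤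
      ∫ t in T₁..T₂, (∑ p ∈ P, (a p : ℂ) * cexp (↑(-1 * Real.log p * t) * I)).im ^ (2 * k) := by
  set m := 2 * k with hm
  set E : ℝ := 2 * x ^ m * (∑ p ∈ P, |a p|) ^ m with hE
  set J : ℝ := ∫ t in T₁..T₂, (∑ p ∈ P, (a p : ℂ) * cexp (↑(-1 * Real.log p * t) * I)).im ^ m
    with hJ
  set D : ℝ := (T₂ - T₁) * ((k.factorial : ℝ) *
        ∑ f ∈ (piFinset fun _ : Fin k => P).filter (fun f => Function.Injective f),
          (∏ i, a (f i)) ^ 2) with hD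
  -- the mixed moments
  set M : ℕ → ℂ := fun j => ∫ t in T₁..T₂,
      (∑ p ∈ P, (a p : ℂ) * cexp (↑(-1 * Real.log p * t) * I)) ^ j *
        (starRingEnd ℂ) (∑ p ∈ P, (a p : ℂ) * cexp (↑(-1 * Real.log p * t) * I)) ^ (m - j) with hMdef
  have hid := twoI_pow_mul_integral_im_pow a P m T₁ T₂
  have hE0 : 0 ≤ E := by positivity
  -- `(2i)^{2k} = (-4)^k`
  have h2I : (2 * I : ℂ) ^ m = (((-4 : ℝ) ^ k : ℝ) : ℂ) := by
    rw [hm, pow_mul]; push_cast; congr 1; ring_nf; rw [I_sq]; ring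
  -- real parts: `(-4)^k J = ∑_j C(m,j) (-1)^{m-j} Re M_j`
  have hre : (-4 : ℝ) ^ k * J = ∑ j ∈ range (m + 1), (m.choose j : ℝ) * (-1) ^ (m - j) * (M j).re := by
    have := congrArg Complex.re hid
    rw [h2I, ← ofReal_mul, ofReal_re, re_sum] at this
    rw [this]
    refine sum_congr rfl fun j _ => ?_
    rw [show ((m.choose j : ℕ) : ℂ) * (-1) ^ (m - j) = (((m.choose j : ℝ) * (-1) ^ (m - j) : ℝ) : ℂ) by
      push_cast; ring, re_ofReal_mul]
  -- off-diagonal `j ≠ k`: `|Re M_j| ≤ E`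
  have hoff : ∀ j ∈ (range (m + 1)).erase k, |(M j).re| ≤ E := by
    intro j hj
    have hjk : j ≠ k := (mem_erase.1 hj).1
    have hjm : j ≤ m := Nat.lt_succ_iff.1 (mem_range.1 (mem_erase.1 hj).2)
    have hjl : j ≠ m - j := by omega
    have := norm_integral_pow_mul_conj_pow_le hP hx hx1 a hjl T₁ T₂
    rw [Nat.add_sub_cancel' hjm] at this
    exact (abs_re_le_norm _).trans this
  -- diagonal `j = k`: `Re M_k ≥ D - E`
  have hdiag : D - E ≤ (M k).re := by
    have := re_integral_pow_mul_conj_pow_ge hP hx hx1 ha k hT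
    have hmk : m - k = k := by omega
    simp only [hMdef, hmk]
    rwa [← two_mul] at this
  -- isolate `j = k` in the sum
  have hk : k ∈ range (m + 1) := mem_range.2 (by omega)
  rw [← add_sum_erase _ _ hk] at hre
  have hmk : m - k = k := by omega
  -- multiply by `(-1)^k`: `4^k J = C(m,k) Re M_k + ∑_{j ≠ k} C(m,j) (-1)^{m-j+k} Re M_j`
  have hsgn : ((-1 : ℝ) ^ k) * (-4 : ℝ) ^ k = 4 ^ k := by
    rw [← mul_pow]; norm_num
  have hmain : (4 : ℝ) ^ k * J = (m.choose k : ℝ) * (M k).re +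
      (-1 : ℝ) ^ k * ∑ j ∈ (range (m + 1)).erase k, (m.choose j : ℝ) * (-1) ^ (m - j) * (M j).re := by
    have := congrArg (fun r => ((-1 : ℝ) ^ k) * r) hre
    rw [← mul_assoc, hsgn] at this
    rw [this, mul_add, hmk]
    have h1 : ((-1 : ℝ) ^ k) * (-1) ^ k = 1 := by rw [← mul_pow]; norm_num
    linear_combination ((m.choose k : ℝ) * (M k).re) * h1
  -- bound the rest
  have hrest : |(-1 : ℝ) ^ k * ∑ j ∈ (range (m + 1)).erase k,
      (m.choose j : ℝ) * (-1) ^ (m - j) * (M j).re| ≤ ((4 : ℝ) ^ k - m.choose k) * E := by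
    rw [abs_mul, abs_pow, abs_neg, abs_one, one_pow, one_mul]
    refine (abs_sum_le_sum_abs _ _).trans ?_
    calc _ ≤ ∑ j ∈ (range (m + 1)).erase k, (m.choose j : ℝ) * E := by
          refine sum_le_sum fun j hj => ?_
          rw [abs_mul, abs_mul, abs_pow, abs_neg, abs_one, one_pow, mul_one, Nat.abs_cast]
          exact mul_le_mul_of_nonneg_left (hoff j hj) (Nat.cast_nonneg _)
      _ = ((4 : ℝ) ^ k - m.choose k) * E := by
          rw [← sum_mul]
          congr 1
          have h4 : ∑ j ∈ range (m + 1), (m.choose j : ℝ) = 4 ^ k := by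
            rw [← Nat.cast_sum, Nat.sum_range_choose, hm, pow_mul]; norm_num
          rw [← add_sum_erase _ _ hk] at h4
          linarith
  have hchoose_le : (m.choose k : ℝ) ≤ 4 ^ k := by
    have h4 : ∑ j ∈ range (m + 1), (m.choose j : ℝ) = 4 ^ k := by
      rw [← Nat.cast_sum, Nat.sum_range_choose, hm, pow_mul]; norm_num
    rw [← h4]
    exact single_le_sum (fun j _ => Nat.cast_nonneg _) hk
  have h4J : (m.choose k : ℝ) * D - 4 ^ k * E ≤ (4 : ℝ) ^ k * J := by
    rw [hmain]
    have h1 : (m.choose k : ℝ) * (D - E) ≤ (m.choose k : ℝ) * (M k).re :=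
      mul_le_mul_of_nonneg_left hdiag (Nat.cast_nonneg _)
    have h2 := neg_le_of_abs_le hrest
    nlinarith
  have h4pos : (0 : ℝ) < 4 ^ k := by positivity
  rw [div_mul_eq_mul_div, div_sub' h4pos.ne', div_le_iff₀ h4pos]
  linarith

/-! ### Injective tuples: the lower bound for the diagonal -/

/-- Re-indexing `(k+1)`-tuples as (head, tail). [folklore] -/
theorem sum_piFinset_succ (P : Finset ℕ) (k : ℕ) (φ : (Fin (k + 1) → ℕ) → ℝ) :
    ∑ g ∈ piFinset fun _ : Fin (k + 1) => P, φ g =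
      ∑ p ∈ P, ∑ f ∈ piFinset fun _ : Fin k => P, φ (Fin.cons p f) := by
  have hmap : (piFinset fun _ : Fin (k + 1) => P) =
      (P ×ˢ piFinset (Fin.tail fun _ : Fin (k + 1) => P)).map
        (Fin.consEquiv fun _ => ℕ).toEmbedding := by
    have := Finset.filter_piFinset_eq_map_consEquiv (fun _ : Fin (k + 1) => P) (fun _ => True)
    simpa using this
  rw [hmap, sum_map, sum_product]
  rfl

/-- The number of injective `k`-tuples weighted by `∏ w(fᵢ)`, `I_k(P, w)`, is monotone in `P`
for `w ≥ 0`. [folklore] -/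
theorem sum_injective_mono {P' P : Finset ℕ} (hP' : P' ⊆ P) {w : ℕ → ℝ} (hw : ∀ p ∈ P, 0 ≤ w p)
    (k : ℕ) :
    ∑ f ∈ (piFinset fun _ : Fin k => P').filter (fun f => Function.Injective f), ∏ i, w (f i) ≤
      ∑ f ∈ (piFinset fun _ : Fin k => P).filter (fun f => Function.Injective f), ∏ i, w (f i) :=
  sum_le_sum_of_subset_of_nonneg
    (filter_subset_filter _ (piFinset_subset _ _ fun _ => hP'))
    fun _ hf _ => prod_nonneg fun i _ => hw _ (mem_piFinset.1 (mem_filter.1 hf).1 i)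

/-- The recursion `I_{k+1} ≥ (S - kμ) I_k` for `0 ≤ w ≤ μ` on `P`, `S = ∑_P w`: extending an
injective `k`-tuple by a new head `p ∉ {f₁,…,f_k}` loses at most `k` values of weight `≤ μ` each.
[cite: Tsang1986, Lemma 3, proof] -/
theorem sum_injective_succ_ge {w : ℕ → ℝ} {μ : ℝ} (hw : ∀ p ∈ P, 0 ≤ w p) (hwμ : ∀ p ∈ P, w p ≤ μ)
    (hμ : 0 ≤ μ) (k : ℕ) :
    (∑ p ∈ P, w p - k * μ) *
        ∑ f ∈ (piFinset fun _ : Fin k => P).filter (fun f => Function.Injective f), ∏ i, w (f i) ≤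
      ∑ g ∈ (piFinset fun _ : Fin (k + 1) => P).filter (fun g => Function.Injective g),
        ∏ i, w (g i) := by
  classical
  have hR : ∑ g ∈ (piFinset fun _ : Fin (k + 1) => P).filter (fun g => Function.Injective g),
      ∏ i, w (g i) = ∑ f ∈ piFinset fun _ : Fin k => P, ∑ p ∈ P,
        (if Function.Injective (Fin.cons p f : Fin (k + 1) → ℕ) then
          ∏ i, w ((Fin.cons p f : Fin (k + 1) → ℕ) i) else 0) := by
    rw [sum_filter, sum_piFinset_succ, sum_comm]
  have hL : ∑ f ∈ (piFinset fun _ : Fin k => P).filter (fun f => Function.Injective f),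
      ∏ i, w (f i) = ∑ f ∈ piFinset fun _ : Fin k => P,
        if Function.Injective f then ∏ i, w (f i) else 0 := sum_filter _ _
  rw [hR, hL, mul_sum]
  refine sum_le_sum fun f hf => ?_
  by_cases hinj : Function.Injective f
  · rw [if_pos hinj]
    -- the inner sum over admissible heads
    have hcons : ∀ p ∈ P, (if Function.Injective (Fin.cons p f : Fin (k + 1) → ℕ) then
        ∏ i, w ((Fin.cons p f : Fin (k + 1) → ℕ) i) else 0) =
        if p ∉ Set.range f then w p * ∏ i, w (f i) else 0 := by
      intro p _
      by_cases hp : p ∉ Set.range f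
      · rw [if_pos (Fin.cons_injective_iff.2 ⟨hp, hinj⟩), if_pos hp, Fin.prod_univ_succ]
        simp
      · rw [if_neg (fun h => hp (Fin.cons_injective_iff.1 h).1), if_neg hp]
    rw [sum_congr rfl hcons, ← sum_filter, ← sum_mul]
    refine mul_le_mul_of_nonneg_right ?_ (prod_nonneg fun i _ => hw _ (mem_piFinset.1 hf i))
    -- `∑_{p ∉ range f} w p ≥ S - k μ`
    have hsplit := sum_filter_add_sum_filter_not P (fun p => p ∉ Set.range f) w
    have hin : ∑ p ∈ P.filter (fun p => ¬ p ∉ Set.range f), w p ≤ k * μ := by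
      calc _ ≤ ∑ p ∈ P.filter (fun p => ¬ p ∉ Set.range f), μ :=
            sum_le_sum fun p hp => hwμ _ (mem_filter.1 hp).1
        _ = (P.filter (fun p => ¬ p ∉ Set.range f)).card * μ := by rw [sum_const, nsmul_eq_mul]
        _ ≤ k * μ := by
            refine mul_le_mul_of_nonneg_right ?_ hμ
            have hsub : P.filter (fun p => ¬ p ∉ Set.range f) ⊆ univ.image f := by
              intro p hp
              obtain ⟨i, rfl⟩ := Set.mem_range.1 (not_not.1 (mem_filter.1 hp).2)
              exact mem_image_of_mem f (mem_univ i)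
            calc ((P.filter (fun p => ¬ p ∉ Set.range f)).card : ℝ) ≤ (univ.image f).card := by
                  exact_mod_cast card_le_card hsub
              _ ≤ k := by
                  have := card_image_le (s := (univ : Finset (Fin k))) (f := f)
                  rw [card_univ, Fintype.card_fin] at this
                  exact_mod_cast this
    linarith
  · rw [if_neg hinj, mul_zero]
    refine sum_nonneg fun p hp => ?_
    split_ifs
    · exact prod_nonneg fun i _ => by
        refine hw _ ?_
        rcases Fin.eq_zero_or_eq_succ i with rfl | ⟨j, rfl⟩
        · simpa using hp
        · simpa using mem_piFinset.1 hf j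
    · exact le_rfl

/-- `I_0 = 1`. [folklore] -/
theorem sum_injective_zero (P : Finset ℕ) (w : ℕ → ℝ) :
    ∑ f ∈ (piFinset fun _ : Fin 0 => P).filter (fun f => Function.Injective f), ∏ i, w (f i) = 1 := by
  have hfilter : (piFinset fun _ : Fin 0 => P).filter (fun f => Function.Injective f) =
      piFinset fun _ : Fin 0 => P :=
    filter_true_of_mem fun f _ => Function.injective_of_subsingleton f
  rw [hfilter]
  simp

/-- **Lower bound for the weighted count of injective tuples**: if `0 ≤ w ≤ μ` on `P`,
`S = ∑_P w` and `(k-1)μ ≤ S`, then `∏_{i<k} (S - iμ) ≤ I_k(P, w)`. [cite: Tsang1986, Lemma 3, proof] -/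
theorem prod_sub_le_sum_injective {w : ℕ → ℝ} {μ : ℝ} (hw : ∀ p ∈ P, 0 ≤ w p)
    (hwμ : ∀ p ∈ P, w p ≤ μ) (hμ : 0 ≤ μ) :
    ∀ k : ℕ, ((k : ℝ) - 1) * μ ≤ ∑ p ∈ P, w p →
      ∏ i ∈ range k, (∑ p ∈ P, w p - i * μ) ≤
        ∑ f ∈ (piFinset fun _ : Fin k => P).filter (fun f => Function.Injective f), ∏ i, w (f i)
  | 0, _ => by rw [sum_injective_zero, prod_range_zero]
  | k + 1, hk => by
      have hk' : ((k : ℝ) - 1) * μ ≤ ∑ p ∈ P, w p := by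
        push_cast at hk
        nlinarith
      have ih := prod_sub_le_sum_injective hw hwμ hμ k hk'
      have hrec := sum_injective_succ_ge hw hwμ hμ k
      have hnonneg : 0 ≤ ∑ p ∈ P, w p - k * μ := by push_cast at hk; linarith
      rw [prod_range_succ, mul_comm]
      exact (mul_le_mul_of_nonneg_left ih hnonneg).trans hrec

/-- The product `∏_{i<k} (S - iμ)` against its smallest factor. [folklore] -/
theorem pow_le_prod_sub {S μ : ℝ} (hμ : 0 ≤ μ) (k : ℕ) (hk : ((k : ℝ) - 1) * μ ≤ S) :
    (S - ((k : ℝ) - 1) * μ) ^ k ≤ ∏ i ∈ range k, (S - i * μ) := by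
  rw [← card_range k, ← prod_const, card_range]
  refine prod_le_prod (fun i _ => by linarith) fun i hi => ?_
  have hi' : (i : ℝ) ≤ k - 1 := by
    have := mem_range.1 hi
    have : (i : ℝ) + 1 ≤ k := by exact_mod_cast this
    linarith
  nlinarith

/-! ### The bounds in the form used in Tsang §3 -/

/-- `W` is continuous (a trigonometric polynomial). [folklore] -/
theorem continuous_im_primePoly (a : ℕ → ℝ) (P : Finset ℕ) :
    Continuous fun t : ℝ => (∑ p ∈ P, (a p : ℂ) * cexp (↑(-1 * Real.log p * t) * I)).im := by
  fun_prop

/-- The trivial bound `|W(t)| ≤ ∑_p |a_p|`. [folklore] -/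
theorem abs_im_primePoly_le (a : ℕ → ℝ) (P : Finset ℕ) (t : ℝ) :
    |(∑ p ∈ P, (a p : ℂ) * cexp (↑(-1 * Real.log p * t) * I)).im| ≤ ∑ p ∈ P, |a p| := by
  refine (abs_im_le_norm _).trans ((norm_sum_le _ _).trans (le_of_eq (sum_congr rfl fun p _ => ?_)))
  rw [norm_mul, norm_real, Real.norm_eq_abs, norm_exp_ofReal_mul_I, mul_one]

/-- **Even moments of `W`, final form** (Tsang 1986, Lemma 3 in the crude form that suffices for
Selberg's theorem): let `P` be a set of primes `≤ x` (`x ≥ 1`) with coefficients `a_p ≥ 0`, and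
`P' ⊆ P` a sub-range on which `a_p² ≤ μ` and `S' := ∑_{P'} a_p² ≥ (k-1)μ`. Then
`∫_{T₁}^{T₂} W^{2k} ≥ 4^{-k} C(2k,k) k! (T₂ - T₁) (S' - (k-1)μ)^k - 2 x^{2k} (∑_P |a_p|)^{2k}`.
(Tsang restricts to `λ < p ≤ x^{3/4}` with `λ = 2k log k`; any sub-range may be used.)
[cite: Tsang1986, Lemma 3 and §3 p. 382] -/
theorem integral_im_pow_even_ge_of_subset (hP : ∀ p ∈ P, p.Prime) (hx : ∀ p ∈ P, (p : ℝ) ≤ x)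
    (hx1 : 1 ≤ x) {a : ℕ → ℝ} (ha : ∀ p ∈ P, 0 ≤ a p) {P' : Finset ℕ} (hP' : P' ⊆ P) {μ : ℝ}
    (hμ : 0 ≤ μ) (haμ : ∀ p ∈ P', a p ^ 2 ≤ μ) (k : ℕ)
    (hk : ((k : ℝ) - 1) * μ ≤ ∑ p ∈ P', a p ^ 2) {T₁ T₂ : ℝ} (hT : T₁ ≤ T₂) :
    ((2 * k).choose k : ℝ) / 4 ^ k * ((T₂ - T₁) * ((k.factorial : ℝ) *
        (∑ p ∈ P', a p ^ 2 - ((k : ℝ) - 1) * μ) ^ k)) - 2 * x ^ (2 * k) * (∑ p ∈ P, |a p|) ^ (2 * k) ≤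
      ∫ t in T₁..T₂, (∑ p ∈ P, (a p : ℂ) * cexp (↑(-1 * Real.log p * t) * I)).im ^ (2 * k) := by
  refine le_trans ?_ (integral_im_pow_even_ge hP hx hx1 ha k hT)
  have hI : (∑ p ∈ P', a p ^ 2 - ((k : ℝ) - 1) * μ) ^ k ≤
      ∑ f ∈ (piFinset fun _ : Fin k => P).filter (fun f => Function.Injective f),
        (∏ i, a (f i)) ^ 2 := by
    calc _ ≤ ∏ i ∈ range k, (∑ p ∈ P', a p ^ 2 - i * μ) := pow_le_prod_sub hμ k hk
      _ ≤ ∑ f ∈ (piFinset fun _ : Fin k => P').filter (fun f => Function.Injective f),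
            ∏ i, a (f i) ^ 2 :=
          prod_sub_le_sum_injective (fun p _ => sq_nonneg (a p)) haμ hμ k hk
      _ ≤ ∑ f ∈ (piFinset fun _ : Fin k => P).filter (fun f => Function.Injective f),
            ∏ i, a (f i) ^ 2 := sum_injective_mono hP' (fun p _ => sq_nonneg (a p)) k
      _ = _ := sum_congr rfl fun f _ => prod_pow _ 2 _
  have hT' : 0 ≤ T₂ - T₁ := sub_nonneg.2 hT
  have hc : 0 ≤ ((2 * k).choose k : ℝ) / 4 ^ k * ((T₂ - T₁) * (k.factorial : ℝ)) := by positivity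
  nlinarith [mul_le_mul_of_nonneg_left hI hc]

end Tsang1986

end Literature.NumberTheory.LFunctions

end
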